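import Literature.IUT.HodgeTheaters.SplitFrobenioids
import Literature.AlgebraicGeometry.Frobenioids.PadicFrobenioidBaseTransport
import Literature.AlgebraicGeometry.Frobenioids.PadicFrobenioidQp
import Mathlib.CategoryTheory.Adjunction.FullyFaithful
import HarnessLib

/-!
# [IUTchI] Example 3.3 assembled from abc-iut-L1-t4's [FrdII] kit: `GoodLocalFrobenioid.ofKit` (MERGE L5 × L1)

Mochizuki, *Inter-universal Teichmüller Theory I*, kurims manuscript (May 2020), Example 3.3 (i)–(ii), pp. 77–79
[cite: Mochizuki2012, I Ex 3.3 pp.77-79] (D-0012 claim key, status disputed; nothing of the series is asserted — this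
file CONSTRUCTS an inhabitant of abc-iut-L5-t2's frozen interface `GoodLocalFrobenioid p K_v` (`SplitFrobenioids.lean`,
Ex. 3.3 typed with "TODO-merge:abc-iut-L1-t4" fields) from the REAL [FrdII] Example 1.1 objects exported for exactly
this purpose by abc-iut-L1-t4 (`PadicFrd.GoodLocalKit.*`, `PadicFrobenioidGoodLocalKit.lean`,
`PadicFrobenioidBaseTransport.lean` [cite: MochizukiFrdII2008, Ex 1.1 (ii) p.8]).

INPUT = the BASE of Ex. 3.3 (i): small categories `D_v ⊇ D⊢_v` (print: `𝓑(X̲→_v)⁰ ⊇ 𝓑(K_v)⁰`) with `incl` full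
and faithful, `proj ⊣ incl` ("a natural functor `D_v → D⊢_v`, which is left-adjoint to the natural inclusion
functor"), both connected and totally epimorphic; the field functor `base : D⊢_v → D₀` ("`Spec(L) ∈ Ob(D⊢_v)`")
landing in `p`-adic local fields; and the Type-0 carrier `K_v ∋ p_v` of the interface. (The REAL base — coset
categories of `Π_v ↠ G_v` and `Spec L ↦ L` on `Gal(K̄_v/K_v)` — is `GoodLocalFrobenioid.ofGalois`,
`GoodLocalFrobenioidOfGalois.lean`.)
DICTIONARY (interface field ← kit): `PhiC ← GoodLocalKit.PhiC` (`Φ_{C_v} : Spec(L) ↦ ord(𝒪^▷_L)^pf` on `D⊢_v`),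
`PhiCdash ← PhiCdash` (`ℕ·ord(p_v)`), `PhiIncl`, `logp`/`logp_generates`, `Cv ← CvOver` (the `p_v`-adic Frobenioid of
`Φ_{C_v}` pulled back along `proj`, over `D_v`), `Cdash ← Cdash` (over `D⊢_v`), `CdashToC ← CdashToCOver … incl ε`
with `ε :=` the counit of `proj ⊣ incl` (FAITHFUL — abc-iut-L1-t4's `CdashToCOver_faithful`, the counit being an
isomorphism since `incl` is fully faithful), `CdashToC_base ← CdashToCOver_comp_baseFunctor` (on the nose), `tauDash ← tauDash` (= [FrdII] Thm. 1.2 (v),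
`Datum.primSplitting`, through the `S3Local.CharSplitting` adapter), `p_mem ← K_v`.
MODELLING CHOICE (disclosed): print's `C^Θ_v` is "some `p_v`-adic Frobenioid … equipped with `τ^Θ_v` determined by
`log(p_v)·log(Θ)`", obtained "by replacing `log(p_v)` by the formal symbol `log(p_v)·log(Θ)`", "naturally
isomorphic" to `C⊢_v`: we take `C^Θ_v := C⊢_v` with the generator READ as that symbol, so the printed natural
equivalence `F⊢_v ⥲ F^Θ_v` is the identity (the two split Frobenioids are isomorphic copies by construction).
NON-VACUITY: `ofKitQp p` over the one-object base `Spec ℚ_p` (abc-iut-L1-t4's `qpBase`).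
-/

namespace Literature.IUT.HodgeTheaters

open CategoryTheory Opposite
open Literature.AlgebraicGeometry.Frobenioids Literature.AlgebraicGeometry.Frobenioids.PadicFrd

universe u

namespace GoodLocalFrobenioid

/-! ### The assembly over a given base -/

section OfKit

variable {p : ℕ} [Fact p.Prime] {Dv Dd : Type u} [Category.{u} Dv] [Category.{u} Dd]
  (incl : Dd ⥤ Dv) (proj : Dv ⥤ Dd) (adj : proj ⊣ incl)
  (base : Dd ⥤ PadicFld.{u} p) (hloc : ∀ A : Dd, (base.obj A).IsPadicLocal)
  (hc : IsConnected Dd) (he : IsTotallyEpimorphic Dd) (hcV : IsConnected Dv) (heV : IsTotallyEpimorphic Dv)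

include hloc in
/-- The objects of `D_v` lie over `p`-adic local fields ("by pull-back via `D_v → D⊢_v`").
[claim: Mochizuki2012, status: disputed] -/
theorem hlocOver : ∀ A : Dv, ((proj ⋙ base).obj A).IsPadicLocal := fun A => hloc (proj.obj A)

/-- **`C⊢_v ⊆ C_v` is FAITHFUL** for `ε :=` the counit of `proj ⊣ incl` with `incl` fully faithful (then `ε` is an
isomorphism; abc-iut-L1-t4's `GoodLocalKit.CdashToCOver_faithful`). [claim: Mochizuki2012, status: disputed] -/
theorem cdashToCOver_faithful [incl.Full] [incl.Faithful] :
    (GoodLocalKit.CdashToCOver base hloc hc he proj (hlocOver proj base hloc) hcV heV incl adj.counit).Faithful :=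
  GoodLocalKit.CdashToCOver_faithful base hloc hc he proj (hlocOver proj base hloc) hcV heV incl adj.counit

variable (Kv : Type) [Field Kv] [ValuativeRel Kv] (hp : ((p : Kv)) ∈ PadicFrd.intNonzero Kv) [incl.Full] [incl.Faithful]

/-- **[IUTchI] Example 3.3 (i)–(ii) assembled from the [FrdII] kit** over a given base
`(D_v ⊇ D⊢_v, proj ⊣ incl, Spec L ↦ L)` and completed field `K_v ∋ p_v`: every Frobenioid-theoretic field of the
interface is abc-iut-L1-t4's REAL object (module docstring: dictionary and the disclosed modelling choice for `C^Θ_v`).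
[claim: Mochizuki2012, status: disputed] -/
noncomputable def ofKit : GoodLocalFrobenioid.{u} p Kv where
  Dv := Dv
  Ddash := Dd
  incl := incl
  proj := proj
  adj := adj
  PhiC := GoodLocalKit.PhiC base hloc hc he
  PhiCdash := GoodLocalKit.PhiCdash base hloc hc he
  PhiIncl := GoodLocalKit.PhiIncl base hloc hc he
  PhiIncl_injective A := fun _ _ h => GoodLocalKit.PhiIncl_injective base hloc hc he A h
  logp := GoodLocalKit.logp base hloc hc he
  logp_generates := GoodLocalKit.logp_generates base hloc hc he
  Cv := GoodLocalKit.CvOver base proj (hlocOver proj base hloc) hcV heV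
  toBase := ModelFrobenioid.baseFunctor _ _ _
  Cdash := GoodLocalKit.Cdash base hloc hc he
  CdashBase := GoodLocalKit.CdashBase base hloc hc he
  CdashToC := GoodLocalKit.CdashToCOver base hloc hc he proj (hlocOver proj base hloc) hcV heV incl adj.counit
  CdashToC_faithful := cdashToCOver_faithful incl proj adj base hloc hc he hcV heV
  CdashToC_base := ⟨eqToIso
    (GoodLocalKit.CdashToCOver_comp_baseFunctor base hloc hc he proj (hlocOver proj base hloc) hcV heV incl adj.counit)⟩
  p_mem := hp
  tauDash := ⟨(GoodLocalKit.tauDash base hloc hc he).τ⟩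
  CTheta := GoodLocalKit.Cdash base hloc hc he
  CThetaBase := GoodLocalKit.CdashBase base hloc hc he
  tauTheta := ⟨(GoodLocalKit.tauDash base hloc hc he).τ⟩
  dashThetaEquiv := CategoryTheory.Equivalence.refl
  dashThetaEquiv_tau A := by
    ext e
    refine ⟨?_, fun h => ⟨e, h, rfl⟩⟩
    rintro ⟨e', he', rfl⟩
    exact he'
  dashThetaEquiv_base := ⟨(Functor.leftUnitor _).symm⟩

/-- `Φ_{C_v}` of `ofKit` IS `Spec(L) ↦ ord(𝒪^▷_L)^pf` ([FrdII] perfection datum) and `Φ_{C⊢_v}` IS `ℕ·ord(p_v)`.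
[claim: Mochizuki2012, status: disputed] -/
theorem ofKit_Phi :
    (ofKit incl proj adj base hloc hc he hcV heV Kv hp).PhiC = (Datum.perf base hloc hc he).Φ ∧
      (ofKit incl proj adj base hloc hc he hcV heV Kv hp).PhiCdash = (Datum.prim base hloc hc he).Φ :=
  ⟨rfl, rfl⟩

/-- `C_v`, `C⊢_v = C^Θ_v` of `ofKit` ARE the REAL `p_v`-adic Frobenioids (model Frobenioids of `Datum.perf` pulled
back along `proj`, resp. of `Datum.prim`). [claim: Mochizuki2012, status: disputed] -/
theorem ofKit_C :
    (ofKit incl proj adj base hloc hc he hcV heV Kv hp).Cv =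
        (Datum.perf (proj ⋙ base) (hlocOver proj base hloc) hcV heV).frobenioid ∧
      (ofKit incl proj adj base hloc hc he hcV heV Kv hp).Cdash = (Datum.prim base hloc hc he).frobenioid ∧
      (ofKit incl proj adj base hloc hc he hcV heV Kv hp).CTheta = (Datum.prim base hloc hc he).frobenioid :=
  ⟨rfl, rfl, rfl⟩

/-- `τ⊢_v` of `ofKit` IS [FrdII] Thm. 1.2 (v)'s splitting determined by `p_v` (`Datum.primSplitting`).
[claim: Mochizuki2012, status: disputed] -/
theorem ofKit_tauDash (A : (Datum.prim base hloc hc he).frobenioid) :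
    (ofKit incl proj adj base hloc hc he hcV heV Kv hp).tauDash.sect A =
      (Datum.primSplitting base hloc hc he).τ A :=
  rfl

/-- `C⊢_v → C_v → D_v` equals `C⊢_v → D⊢_v → D_v` on the nose. [claim: Mochizuki2012, status: disputed] -/
theorem ofKit_CdashToC_toBase :
    (ofKit incl proj adj base hloc hc he hcV heV Kv hp).CdashToC ⋙ (ofKit incl proj adj base hloc hc he hcV heV Kv hp).toBase =
      (ofKit incl proj adj base hloc hc he hcV heV Kv hp).CdashBase ⋙ incl :=
  GoodLocalKit.CdashToCOver_comp_baseFunctor base hloc hc he proj (hlocOver proj base hloc) hcV heV incl adj.counit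

end OfKit

/-! ### Non-vacuity over the one-object base `Spec ℚ_p` -/

/-- **Ex. 3.3 over `Spec ℚ_p` with trivial `π₁`** (`D_v = D⊢_v =` the one-object category, `K_v = ℚ_p`): the REAL
[FrdII] Frobenioids `C(ℚ_p) ⊇ C⊢(ℚ_p)` of abc-iut-L1-t4's `qpBase`, every hypothesis discharged.
[claim: Mochizuki2012, status: disputed] -/
noncomputable def ofKitQp (p : ℕ) [Fact p.Prime] : GoodLocalFrobenioid.{0} p ℚ_[p] :=
  ofKit (𝟭 (Discrete PUnit.{1})) (𝟭 _) Adjunction.id (qpBase p) (fun _ => isPadicLocal_qpFld p)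
    inferInstance (isTotallyEpimorphic_discretePUnit) inferInstance (isTotallyEpimorphic_discretePUnit) ℚ_[p]
    (p_mem_intNonzero p)

end GoodLocalFrobenioid

end Literature.IUT.HodgeTheaters
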